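import Mathlib.CategoryTheory.Limits.Preserves.Shapes.Equalizers
import Mathlib.CategoryTheory.Limits.Preserves.Shapes.BinaryProducts
import Mathlib.CategoryTheory.Limits.Preserves.Shapes.Pullbacks
import Mathlib.CategoryTheory.Limits.Shapes.FiniteLimits
import Mathlib.CategoryTheory.Adjunction.Limits
import Mathlib.GroupTheory.GroupAction.SubMulAction
import Literature.AnabelianGeometry.SemiGraphs.QuasiTemperoidsQDPairs
import Literature.AnabelianGeometry.SemiGraphs.BTempLimitsProofs
import Literature.AnabelianGeometry.SemiGraphs.BTempStructureProofs
import Literature.AnabelianGeometry.SemiGraphs.TemperoidsCountablyConnectedTransport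
import Literature.AlgebraicGeometry.Frobenioids.QuasiTemperoidConnected
import HarnessLib

/-!
# Semi-graphs of anabelioids, Appendix: Theorem A.4 — the UNIQUENESS clause (proof)

Mochizuki, *Semi-graphs of anabelioids*, Publ. RIMS **42** (2006), Appendix "Quasi-temperoids",
Theorem A.4 (manuscript pp. 82–86) [cite: MochizukiSemiAnbd2006, Thm A.4 pp.82-86]: for connected
temperoids `T₁, T₂`, connected objects `A_i ∈ T_i` and `λ_i : Q_i := T_i[A_i] → T_i` the natural functors,
"any morphism of quasi-temperoids `φ : Q₁ → Q₂` fits into a 1-commutative diagram [`λ₂ ∘ φ ≃ ψ ∘ λ₁`] —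
where the morphism of temperoids `ψ : T₁ → T₂` that makes this diagram 1-commute is unique, up to
unique isomorphism".  The named fact `ThmA4` (abc-iut-L3-t2, `QuasiTemperoidsQDPairs.lean`; FACT-LIST
F-1634) types the conclusion as `∃ (ψ, α), ∀ (ψ', α'), ∃! β : ψ^* ≅ ψ'^*, α ≪≫ λ₂^* ◁ β = α'`.  This
PROOF-ONLY companion (no definitions) proves the SECOND HALF — "unique, up to unique isomorphism" —
verbatim in that shape (`thmA4_unique`: for ANY two pairs `(ψ, α)`, `(ψ', α')` over the same `φ` there is
exactly one such `β`), and records the consequence `thmA4_iff_exists`: the named fact is EQUIVALENT to its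
existence half.  The existence half (`φ ↦ ψ` through QD-pairs and quotients `B/Γ_B`, pp. 83–86) is NOT
proved here.

Proof (the uniqueness mechanism of p. 86, choice-free): every object `X` of a connected temperoid
`T₂ ≌ B^temp(Π₂)` is the coequalizer of the two projections `(X × A₂) ×_X (X × A₂) ⇉ X × A₂`, both
objects lying in `T₂[A₂]` (§1 proves this in `B^temp(Π)` for ARBITRARY limit cones — test objects the
countable `Π`-sets `X × A` and `{(p, p′) | p, p′ over the same point}`, no temperedness needed — and §3
transports it along a chart); pull-back functors of morphisms of temperoids preserve countable, hence
finite, colimits (Def. 3.1 (iii)); so a natural isomorphism between two such functors is determined by,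
and can be rebuilt from, its restriction to `T₂[A₂]` (§2, an extension-uniqueness principle for any
category with binary products and pullbacks in which `X × A → X` is the coequalizer of its kernel pair).
`PreservesNondegenerate` and the connectedness of `T₁`, `A₁` are not needed for this half.  Nothing here
takes a side on [IUTchIII] Cor. 3.12.
-/

namespace Literature.AnabelianGeometry.SemiGraphs

open CategoryTheory CategoryTheory.Limits Topology
open Literature.AlgebraicGeometry.Frobenioids (IsConnectedObj IsNonemptyObj)
open Literature.AlgebraicGeometry.Frobenioids.QuasiTemperoid.BTempConnected (hom_ρ)

universe v₁ v₂ u u₁ u₂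

/-! ### §1 In `B^temp(Π)`, `X × A → X` is the coequalizer of its kernel pair -/

section BTempLevel

variable {G : Type u} [Group G] [TopologicalSpace G]

namespace BTemp

/-- Points of a binary-product cone `X ← P → A` of `B^temp(Π)`: every pair `(x, a)` is the image of a
point of `P` (test object: the countable `Π`-set `X × A`, which has open stabilisers) — step of the
presentation of objects of `T` by objects of `T[A]` in the proof of Thm. A.4. [cite: MochizukiSemiAnbd2006, Thm A.4 pp.82-86] -/
theorem exists_point_of_isLimit_binaryFan {P X A : BTemp G} (fst : P ⟶ X) (snd : P ⟶ A)
    (hP : IsLimit (BinaryFan.mk fst snd)) (x : X.obj.V) (a : A.obj.V) :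
    ∃ p : P.obj.V, (fst.hom.hom p : X.obj.V) = x ∧ (snd.hom.hom p : A.obj.V) = a := by
  letI : MulAction G X.obj.V := Action.instMulAction X.obj
  letI : MulAction G A.obj.V := Action.instMulAction A.obj
  haveI : Countable X.obj.V := X.property.1
  haveI : Countable A.obj.V := A.property.1
  let Z : BTemp G := ⟨Action.ofMulAction G (X.obj.V × A.obj.V), by
    refine ⟨inferInstanceAs (Countable (X.obj.V × A.obj.V)), fun (q : X.obj.V × A.obj.V) => ?_⟩
    have : {g : G | (Action.ofMulAction G (X.obj.V × A.obj.V)).ρ g q = q} =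
        {g : G | X.obj.ρ g q.1 = q.1} ∩ {g : G | A.obj.ρ g q.2 = q.2} := by
      ext g
      simp only [Set.mem_setOf_eq, Set.mem_inter_iff]
      change g • q = q ↔ g • q.1 = q.1 ∧ g • q.2 = q.2
      rw [Prod.ext_iff]
      rfl
    rw [this]
    exact (X.property.2 q.1).inter (A.property.2 q.2)⟩
  let π₁ : Z ⟶ X := ObjectProperty.homMk
    { hom := TypeCat.ofHom fun q : X.obj.V × A.obj.V => q.1
      comm := fun _ => by
        apply ConcreteCategory.hom_ext
        intro q
        rfl }
  let π₂ : Z ⟶ A := ObjectProperty.homMk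
    { hom := TypeCat.ofHom fun q : X.obj.V × A.obj.V => q.2
      comm := fun _ => by
        apply ConcreteCategory.hom_ext
        intro q
        rfl }
  obtain ⟨l, h₁, h₂⟩ := BinaryFan.IsLimit.lift' hP π₁ π₂
  exact ⟨l.hom.hom (x, a), congrArg (fun φ : Z ⟶ X => (φ.hom.hom (x, a) : X.obj.V)) h₁,
    congrArg (fun φ : Z ⟶ A => (φ.hom.hom (x, a) : A.obj.V)) h₂⟩

/-- Points of a kernel-pair cone `K ⇉ P` of `P → X` in `B^temp(Π)`: two points of `P` with the same image
are the two images of a point of `K` (test object: the countable `Π`-set of such pairs) — step of the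
same presentation. [cite: MochizukiSemiAnbd2006, Thm A.4 pp.82-86] -/
theorem exists_point_of_isLimit_pullbackCone {P X K : BTemp G} (fst : P ⟶ X) (a b : K ⟶ P)
    (w : a ≫ fst = b ≫ fst) (hK : IsLimit (PullbackCone.mk a b w)) (p p' : P.obj.V)
    (h : (fst.hom.hom p : X.obj.V) = fst.hom.hom p') :
    ∃ k : K.obj.V, (a.hom.hom k : P.obj.V) = p ∧ (b.hom.hom k : P.obj.V) = p' := by
  letI : MulAction G P.obj.V := Action.instMulAction P.obj
  haveI : Countable P.obj.V := P.property.1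
  let S : SubMulAction G (P.obj.V × P.obj.V) :=
    { carrier := {q | (fst.hom.hom q.1 : X.obj.V) = fst.hom.hom q.2}
      smul_mem' := fun g {q} hq => by
        change (fst.hom.hom (P.obj.ρ g q.1) : X.obj.V) = fst.hom.hom (P.obj.ρ g q.2)
        rw [hom_ρ, hom_ρ]
        exact congrArg (fun y => (X.obj.ρ g y : X.obj.V)) hq }
  let Z : BTemp G := ⟨{ V := S, ρ := (Action.ofMulAction G S).ρ }, by
    refine ⟨inferInstanceAs (Countable S), fun (q : S) => ?_⟩
    change IsOpen {g : G | (Action.ofMulAction G S).ρ g q = q}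
    have : {g : G | (Action.ofMulAction G S).ρ g q = q} =
        {g : G | P.obj.ρ g q.1.1 = q.1.1} ∩ {g : G | P.obj.ρ g q.1.2 = q.1.2} := by
      ext g
      simp only [Set.mem_setOf_eq, Set.mem_inter_iff]
      change g • q = q ↔ g • q.1.1 = q.1.1 ∧ g • q.1.2 = q.1.2
      rw [Subtype.ext_iff, SubMulAction.val_smul, Prod.ext_iff]
      rfl
    rw [this]
    exact (P.property.2 q.1.1).inter (P.property.2 q.1.2)⟩
  let s₁ : Z ⟶ P := ObjectProperty.homMk
    { hom := TypeCat.ofHom fun q : S => (q.1.1 : P.obj.V)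
      comm := fun _ => by
        apply ConcreteCategory.hom_ext
        intro q
        rfl }
  let s₂ : Z ⟶ P := ObjectProperty.homMk
    { hom := TypeCat.ofHom fun q : S => (q.1.2 : P.obj.V)
      comm := fun _ => by
        apply ConcreteCategory.hom_ext
        intro q
        rfl }
  have hsq : s₁ ≫ fst = s₂ ≫ fst := by
    apply ObjectProperty.hom_ext
    apply Action.hom_ext
    apply ConcreteCategory.hom_ext
    intro q
    exact q.2
  obtain ⟨l, h₁, h₂⟩ := PullbackCone.IsLimit.lift' hK s₁ s₂ hsq
  exact ⟨l.hom.hom ⟨(p, p'), h⟩,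
    congrArg (fun φ : Z ⟶ P => (φ.hom.hom (⟨(p, p'), h⟩ : S) : P.obj.V)) h₁,
    congrArg (fun φ : Z ⟶ P => (φ.hom.hom (⟨(p, p'), h⟩ : S) : P.obj.V)) h₂⟩

/-- **In `B^temp(Π)`, `X × A → X` is the coequalizer of its kernel pair when `A` has a point** — for any
binary-product cone `X ← P → A` and any kernel-pair cone `K ⇉ P` of `P → X`, the cofork `K ⇉ P → X` is a
colimit: `P → X` is surjective on points, and an equivariant map out of `P` that coequalizes the kernel
pair is constant on fibres, hence descends (equivariantly) to `X`. This is the presentation of an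
arbitrary object of a connected temperoid by objects of `T[A]` behind the uniqueness clause of Thm. A.4.
[cite: MochizukiSemiAnbd2006, Thm A.4 pp.82-86] -/
theorem nonempty_isColimit_cofork_of_isLimit {P X A K : BTemp G} (fst : P ⟶ X) (snd : P ⟶ A)
    (hP : IsLimit (BinaryFan.mk fst snd)) (a₀ : A.obj.V) (a b : K ⟶ P) (w : a ≫ fst = b ≫ fst)
    (hK : IsLimit (PullbackCone.mk a b w)) : Nonempty (IsColimit (Cofork.ofπ fst w)) := by
  classical
  have hsurj : ∀ x : X.obj.V, ∃ p : P.obj.V, (fst.hom.hom p : X.obj.V) = x := fun x =>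
    (exists_point_of_isLimit_binaryFan fst snd hP x a₀).imp fun _ h => h.1
  choose sec hsec using hsurj
  -- an arrow out of `P` coequalizing the kernel pair is constant on the fibres of `P → X`
  have hconst : ∀ (s : Cofork a b) (p p' : P.obj.V), (fst.hom.hom p : X.obj.V) = fst.hom.hom p' →
      (s.π.hom.hom p : s.pt.obj.V) = s.π.hom.hom p' := by
    intro s p p' h
    obtain ⟨k, hk₁, hk₂⟩ := exists_point_of_isLimit_pullbackCone fst a b w hK p p' h
    rw [← hk₁, ← hk₂]
    exact congrArg (fun φ : K ⟶ s.pt => (φ.hom.hom k : s.pt.obj.V)) s.condition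
  refine ⟨Cofork.IsColimit.mk _
    (fun s => ObjectProperty.homMk
      { hom := TypeCat.ofHom fun x : X.obj.V => (s.π.hom.hom (sec x) : s.pt.obj.V)
        comm := fun g => ?_ })
    (fun s => ?_) (fun s m hm => ?_)⟩
  · -- equivariance of the descended map
    apply ConcreteCategory.hom_ext
    intro x
    change (s.π.hom.hom (sec (X.obj.ρ g x)) : s.pt.obj.V) = s.pt.obj.ρ g (s.π.hom.hom (sec x))
    rw [← hom_ρ s.π g (sec x)]
    apply hconst
    rw [hsec, hom_ρ fst g (sec x), hsec]
  · -- factorisation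
    apply ObjectProperty.hom_ext
    apply Action.hom_ext
    apply ConcreteCategory.hom_ext
    intro p
    change (s.π.hom.hom (sec (fst.hom.hom p)) : s.pt.obj.V) = s.π.hom.hom p
    exact hconst s _ _ (hsec _)
  · -- uniqueness (`P → X` is surjective on points)
    apply ObjectProperty.hom_ext
    apply Action.hom_ext
    apply ConcreteCategory.hom_ext
    intro x
    change (m.hom.hom x : s.pt.obj.V) = s.π.hom.hom (sec x)
    have hm' := congrArg (fun φ : P ⟶ s.pt => (φ.hom.hom (sec x) : s.pt.obj.V)) hm
    change (m.hom.hom (fst.hom.hom (sec x)) : s.pt.obj.V) = s.π.hom.hom (sec x) at hm'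
    rwa [hsec] at hm'

end BTemp

end BTempLevel


/-! ### §2 Extension-uniqueness along `T[A] ↪ T` -/

section Extension

variable {T : Type u₂} [Category.{v₂} T] [HasBinaryProducts T] [HasPullbacks T]
  {T₁ : Type u₁} [Category.{v₁} T₁] (A : T)

/-- **Extension-uniqueness principle.** Let `A ∈ T` be such that, for every `X`, the projection
`X × A → X` is the coequalizer of its kernel pair `(X × A) ×_X (X × A) ⇉ X × A` (both in `T[A] = Over' A`).
Then for functors `Ψ, Ψ' : T ⥤ T₁` preserving coequalizers, every natural isomorphism between their
restrictions to `T[A]` is the restriction of a UNIQUE natural isomorphism `Ψ ≅ Ψ'` (components: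
descend `β₀ ≫ Ψ'(pr)` through the epimorphism `Ψ(pr)`). This is the mechanism of the uniqueness clause of
[SemiAnbd] Thm. A.4. [cite: MochizukiSemiAnbd2006, Thm A.4 pp.82-86] -/
theorem existsUnique_iso_of_isoWhiskerLeft_ι
    (hA : ∀ X : T, Nonempty (IsColimit (Cofork.ofπ (prod.fst : X ⨯ A ⟶ X)
      (pullback.condition :
        pullback.fst (prod.fst : X ⨯ A ⟶ X) (prod.fst : X ⨯ A ⟶ X) ≫ prod.fst =
          pullback.snd (prod.fst : X ⨯ A ⟶ X) (prod.fst : X ⨯ A ⟶ X) ≫ prod.fst))))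
    (Ψ Ψ' : T ⥤ T₁) [PreservesColimitsOfShape WalkingParallelPair Ψ]
    [PreservesColimitsOfShape WalkingParallelPair Ψ']
    (β₀ : (admitsHomTo A).ι ⋙ Ψ ≅ (admitsHomTo A).ι ⋙ Ψ') :
    ∃! β : Ψ ≅ Ψ', (admitsHomTo A).ι.isoWhiskerLeft β = β₀ := by
  -- the presentation of `X` by objects of `T[A]`
  let PX : T → Over' A := fun X => ⟨X ⨯ A, ⟨prod.snd⟩⟩
  let KX : T → Over' A := fun X =>
    ⟨pullback (prod.fst : X ⨯ A ⟶ X) (prod.fst : X ⨯ A ⟶ X),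
      ⟨pullback.fst (prod.fst : X ⨯ A ⟶ X) (prod.fst : X ⨯ A ⟶ X) ≫ prod.snd⟩⟩
  let aX : ∀ X, KX X ⟶ PX X := fun X =>
    ObjectProperty.homMk (pullback.fst (prod.fst : X ⨯ A ⟶ X) (prod.fst : X ⨯ A ⟶ X))
  let bX : ∀ X, KX X ⟶ PX X := fun X =>
    ObjectProperty.homMk (pullback.snd (prod.fst : X ⨯ A ⟶ X) (prod.fst : X ⨯ A ⟶ X))
  let qX : ∀ Q : Over' A, PX Q.obj ⟶ Q := fun Q => ObjectProperty.homMk prod.fst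
  let mX : ∀ {X Y : T} (_ : X ⟶ Y), PX X ⟶ PX Y := fun u => ObjectProperty.homMk (prod.map u (𝟙 A))
  -- generic construction: a restricted natural transformation `γ` extends along the epimorphisms `Φ(pr)`
  have key : ∀ (Φ Φ' : T ⥤ T₁) [PreservesColimitsOfShape WalkingParallelPair Φ]
      (γ : (admitsHomTo A).ι ⋙ Φ ⟶ (admitsHomTo A).ι ⋙ Φ'),
      ∃ δ : Φ ⟶ Φ', ∀ X, Φ.map (prod.fst : X ⨯ A ⟶ X) ≫ δ.app X = γ.app (PX X) ≫ Φ'.map prod.fst := by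
    intro Φ Φ' _ γ
    -- components of `γ`, with their types spelled in `T`
    let γP : ∀ X : T, Φ.obj (X ⨯ A) ⟶ Φ'.obj (X ⨯ A) := fun X => γ.app (PX X)
    let γK : ∀ X : T, Φ.obj (pullback (prod.fst : X ⨯ A ⟶ X) (prod.fst : X ⨯ A ⟶ X)) ⟶
        Φ'.obj (pullback (prod.fst : X ⨯ A ⟶ X) (prod.fst : X ⨯ A ⟶ X)) := fun X => γ.app (KX X)
    have n₁ : ∀ X : T, Φ.map (pullback.fst (prod.fst : X ⨯ A ⟶ X) (prod.fst : X ⨯ A ⟶ X)) ≫ γP X =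
        γK X ≫ Φ'.map (pullback.fst (prod.fst : X ⨯ A ⟶ X) (prod.fst : X ⨯ A ⟶ X)) :=
      fun X => γ.naturality (aX X)
    have n₂ : ∀ X : T, Φ.map (pullback.snd (prod.fst : X ⨯ A ⟶ X) (prod.fst : X ⨯ A ⟶ X)) ≫ γP X =
        γK X ≫ Φ'.map (pullback.snd (prod.fst : X ⨯ A ⟶ X) (prod.fst : X ⨯ A ⟶ X)) :=
      fun X => γ.naturality (bX X)
    have nm : ∀ {X Y : T} (u : X ⟶ Y), Φ.map (prod.map u (𝟙 A)) ≫ γP Y = γP X ≫ Φ'.map (prod.map u (𝟙 A)) :=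
      fun u => γ.naturality (mX u)
    have hc : ∀ X : T, IsColimit (Cofork.ofπ (Φ.map (prod.fst : X ⨯ A ⟶ X))
        (by rw [← Φ.map_comp, pullback.condition, Φ.map_comp]) :
        Cofork (Φ.map (pullback.fst (prod.fst : X ⨯ A ⟶ X) (prod.fst : X ⨯ A ⟶ X)))
          (Φ.map (pullback.snd (prod.fst : X ⨯ A ⟶ X) (prod.fst : X ⨯ A ⟶ X)))) :=
      fun X => isColimitCoforkMapOfIsColimit Φ _ (hA X).some
    have w : ∀ X : T, Φ.map (pullback.fst (prod.fst : X ⨯ A ⟶ X) (prod.fst : X ⨯ A ⟶ X)) ≫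
        (γP X ≫ Φ'.map prod.fst) =
        Φ.map (pullback.snd (prod.fst : X ⨯ A ⟶ X) (prod.fst : X ⨯ A ⟶ X)) ≫ (γP X ≫ Φ'.map prod.fst) := by
      intro X
      rw [← Category.assoc, n₁ X, Category.assoc, ← Φ'.map_comp, pullback.condition, Φ'.map_comp,
        ← Category.assoc, ← n₂ X, Category.assoc]
    let δapp : ∀ X : T, Φ.obj X ⟶ Φ'.obj X := fun X =>
      (hc X).desc (Cofork.ofπ (γP X ≫ Φ'.map prod.fst) (w X))
    have hδ : ∀ X : T, Φ.map (prod.fst : X ⨯ A ⟶ X) ≫ δapp X = γP X ≫ Φ'.map prod.fst :=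
      fun X => Cofork.IsColimit.π_desc (hc X)
    haveI : ∀ X : T, Epi (Φ.map (prod.fst : X ⨯ A ⟶ X)) := fun X => epi_of_isColimit_cofork (hc X)
    refine ⟨{ app := δapp, naturality := fun X Y u => ?_ }, hδ⟩
    have hu : (prod.fst : X ⨯ A ⟶ X) ≫ u = prod.map u (𝟙 A) ≫ prod.fst := (prod.map_fst u (𝟙 A)).symm
    rw [← cancel_epi (Φ.map (prod.fst : X ⨯ A ⟶ X)), ← Category.assoc, ← Φ.map_comp, hu, Φ.map_comp,
      Category.assoc, hδ Y, ← Category.assoc, nm u, Category.assoc, ← Φ'.map_comp, ← hu, Φ'.map_comp,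
      ← Category.assoc (Φ.map (prod.fst : X ⨯ A ⟶ X)) (δapp X) (Φ'.map u), hδ X, Category.assoc]
  -- components of `β₀`, with their types spelled in `T`
  let b₀ : ∀ X : T, Ψ.obj (X ⨯ A) ⟶ Ψ'.obj (X ⨯ A) := fun X => β₀.hom.app (PX X)
  let b₀' : ∀ X : T, Ψ'.obj (X ⨯ A) ⟶ Ψ.obj (X ⨯ A) := fun X => β₀.inv.app (PX X)
  have hb₁ : ∀ X : T, b₀ X ≫ b₀' X = 𝟙 _ := fun X => β₀.hom_inv_id_app (PX X)
  have hb₂ : ∀ X : T, b₀' X ≫ b₀ X = 𝟙 _ := fun X => β₀.inv_hom_id_app (PX X)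
  -- epimorphy of `Ψ(pr)`, `Ψ'(pr)`
  have hcΨ : ∀ X : T, IsColimit (Cofork.ofπ (Ψ.map (prod.fst : X ⨯ A ⟶ X))
      (by rw [← Ψ.map_comp, pullback.condition, Ψ.map_comp]) :
      Cofork (Ψ.map (pullback.fst (prod.fst : X ⨯ A ⟶ X) (prod.fst : X ⨯ A ⟶ X)))
        (Ψ.map (pullback.snd (prod.fst : X ⨯ A ⟶ X) (prod.fst : X ⨯ A ⟶ X)))) :=
    fun X => isColimitCoforkMapOfIsColimit Ψ _ (hA X).some
  have hcΨ' : ∀ X : T, IsColimit (Cofork.ofπ (Ψ'.map (prod.fst : X ⨯ A ⟶ X))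
      (by rw [← Ψ'.map_comp, pullback.condition, Ψ'.map_comp]) :
      Cofork (Ψ'.map (pullback.fst (prod.fst : X ⨯ A ⟶ X) (prod.fst : X ⨯ A ⟶ X)))
        (Ψ'.map (pullback.snd (prod.fst : X ⨯ A ⟶ X) (prod.fst : X ⨯ A ⟶ X)))) :=
    fun X => isColimitCoforkMapOfIsColimit Ψ' _ (hA X).some
  haveI : ∀ X : T, Epi (Ψ.map (prod.fst : X ⨯ A ⟶ X)) := fun X => epi_of_isColimit_cofork (hcΨ X)
  haveI : ∀ X : T, Epi (Ψ'.map (prod.fst : X ⨯ A ⟶ X)) := fun X => epi_of_isColimit_cofork (hcΨ' X)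
  -- the two directions
  obtain ⟨δ, hδ₀⟩ := key Ψ Ψ' β₀.hom
  obtain ⟨δ', hδ₀'⟩ := key Ψ' Ψ β₀.inv
  have hδ : ∀ X : T, Ψ.map (prod.fst : X ⨯ A ⟶ X) ≫ δ.app X = b₀ X ≫ Ψ'.map prod.fst := hδ₀
  have hδ' : ∀ X : T, Ψ'.map (prod.fst : X ⨯ A ⟶ X) ≫ δ'.app X = b₀' X ≫ Ψ.map prod.fst := hδ₀'
  have h₁ : ∀ X, δ.app X ≫ δ'.app X = 𝟙 _ := fun X => by
    rw [← cancel_epi (Ψ.map (prod.fst : X ⨯ A ⟶ X)), ← Category.assoc, hδ X, Category.assoc, hδ' X,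
      ← Category.assoc, hb₁ X, Category.id_comp, Category.comp_id]
  have h₂ : ∀ X, δ'.app X ≫ δ.app X = 𝟙 _ := fun X => by
    rw [← cancel_epi (Ψ'.map (prod.fst : X ⨯ A ⟶ X)), ← Category.assoc, hδ' X, Category.assoc, hδ X,
      ← Category.assoc, hb₂ X, Category.id_comp, Category.comp_id]
  let β : Ψ ≅ Ψ' :=
    { hom := δ, inv := δ'
      hom_inv_id := by ext X; exact h₁ X
      inv_hom_id := by ext X; exact h₂ X }
  -- restriction to `T[A]`
  have hres : ∀ Q : Over' A, δ.app Q.obj = β₀.hom.app Q := fun Q => by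
    rw [← cancel_epi (Ψ.map (prod.fst : Q.obj ⨯ A ⟶ Q.obj)), hδ Q.obj]
    exact (β₀.hom.naturality (qX Q)).symm
  refine ⟨β, ?_, fun β' hβ' => ?_⟩
  · ext Q
    exact hres Q
  · ext X
    change β'.hom.app X = δ.app X
    have e : b₀ X = β'.hom.app (X ⨯ A) := by
      change β₀.hom.app (PX X) = _
      rw [← hβ']
      rfl
    rw [← cancel_epi (Ψ.map (prod.fst : X ⨯ A ⟶ X)), hδ X, e]
    exact β'.hom.naturality (prod.fst : X ⨯ A ⟶ X)

end Extension

/-! ### §3 Every object of a connected temperoid is presented by objects of `T[A]` -/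

/-- **In a connected temperoid `T ≌ B^temp(Π)`, for `A` non-initial, `X × A → X` is the coequalizer of
its kernel pair**, for every `X` — transported from `BTemp.nonempty_isColimit_cofork_of_isLimit` along a
chart (the equivalence preserves the product and pullback cones and reflects the colimit cofork; `A`
non-initial gives a point of its image). [cite: MochizukiSemiAnbd2006, Thm A.4 pp.82-86] -/
theorem ConnectedTemperoidChart.nonempty_isColimit_cofork_prod_fst {T : Type u₂} [Category.{v₂} T]
    [HasBinaryProducts T] [HasPullbacks T] (c : ConnectedTemperoidChart.{v₂, u, u₂} T) {A : T}
    (hA : IsNonemptyObj A) (X : T) :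
    Nonempty (IsColimit (Cofork.ofπ (prod.fst : X ⨯ A ⟶ X)
      (pullback.condition :
        pullback.fst (prod.fst : X ⨯ A ⟶ X) (prod.fst : X ⨯ A ⟶ X) ≫ prod.fst =
          pullback.snd (prod.fst : X ⨯ A ⟶ X) (prod.fst : X ⨯ A ⟶ X) ≫ prod.fst))) := by
  let F := c.equiv.functor
  have hP : IsLimit (BinaryFan.mk (F.map (prod.fst : X ⨯ A ⟶ X)) (F.map prod.snd)) :=
    isLimitOfHasBinaryProductOfPreservesLimit F X A
  have hK := isLimitOfHasPullbackOfPreservesLimit F (prod.fst : X ⨯ A ⟶ X) (prod.fst : X ⨯ A ⟶ X)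
  obtain ⟨a₀⟩ := (BTemp.isNonemptyObj_iff (F.obj A)).mp
    (TemperoidTransport.isNonemptyObj_functor_obj c.equiv hA)
  obtain ⟨hc⟩ := BTemp.nonempty_isColimit_cofork_of_isLimit (F.map prod.fst) (F.map prod.snd) hP a₀
    (F.map (pullback.fst (prod.fst : X ⨯ A ⟶ X) (prod.fst : X ⨯ A ⟶ X)))
    (F.map (pullback.snd (prod.fst : X ⨯ A ⟶ X) (prod.fst : X ⨯ A ⟶ X)))
    (by rw [← F.map_comp, pullback.condition, F.map_comp]) hK
  exact ⟨isColimitOfIsColimitCoforkMap F _ hc⟩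

/-! ### §4 Theorem A.4, uniqueness clause -/

/-- **[SemiAnbd] Theorem A.4 — UNIQUENESS of `ψ` up to unique isomorphism, DISCHARGED** (App. pp. 82–86):
for a connected temperoid `T₂`, a connected object `A₂ ∈ T₂`, any category `T₁` with `A₁ ∈ T₁`, a
morphism of quasi-temperoids `φ : T₁[A₁] → T₂[A₂]` (pull-back functor `φ^*`), and ANY two morphisms of
temperoids `ψ, ψ' : T₁ → T₂` with 1-commutation data `α : φ^* ⋙ λ₁^* ≅ λ₂^* ⋙ ψ^*`, `α'` (likewise for
`ψ'`), there is a UNIQUE `β : ψ^* ≅ ψ'^*` with `α ≪≫ (λ₂^* ◁ β) = α'` — the `∀ (ψ', α'), ∃! β` clause of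
the named fact `ThmA4`, for every candidate pair `(ψ, α)`. (Existence of `(ψ, α)` is the other half of
Thm. A.4 and is not asserted here; `φ.PreservesNondegenerate` is not needed for uniqueness.)
[cite: MochizukiSemiAnbd2006, Thm A.4 pp.82-86] -/
theorem thmA4_unique {T₁ : Type u₁} [Category.{v₁} T₁] {T₂ : Type u₂} [Category.{v₂} T₂]
    (h₂ : IsConnectedTemperoid.{v₂, u, u₂} T₂) {A₁ : T₁} {A₂ : T₂} (hA₂ : IsConnectedObj A₂)
    (φ : TemperoidHom (Over' A₁) (Over' A₂)) (ψ ψ' : TemperoidHom T₁ T₂)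
    (α : φ.pullback ⋙ (admitsHomTo A₁).ι ≅ (admitsHomTo A₂).ι ⋙ ψ.pullback)
    (α' : φ.pullback ⋙ (admitsHomTo A₁).ι ≅ (admitsHomTo A₂).ι ⋙ ψ'.pullback) :
    ∃! β : ψ.pullback ≅ ψ'.pullback, α ≪≫ (admitsHomTo A₂).ι.isoWhiskerLeft β = α' := by
  obtain ⟨c⟩ := h₂
  haveI : HasFiniteLimits T₂ := ⟨fun J _ _ => by
    haveI := BTemp.hasLimitsOfShape_of_finCategory (G := c.G) J
    exact Adjunction.hasLimitsOfShape_of_equivalence c.equiv.functor⟩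
  haveI : PreservesColimitsOfShape WalkingParallelPair ψ.pullback :=
    ψ.preservesCountableColimits WalkingParallelPair
  haveI : PreservesColimitsOfShape WalkingParallelPair ψ'.pullback :=
    ψ'.preservesCountableColimits WalkingParallelPair
  obtain ⟨β, hβ, huniq⟩ := existsUnique_iso_of_isoWhiskerLeft_ι A₂
    (fun X => c.nonempty_isColimit_cofork_prod_fst hA₂.1 X) ψ.pullback ψ'.pullback (α.symm ≪≫ α')
  refine ⟨β, ?_, fun γ hγ => huniq γ ?_⟩
  · change α ≪≫ (admitsHomTo A₂).ι.isoWhiskerLeft β = α'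
    rw [hβ, ← Iso.trans_assoc, Iso.self_symm_id, Iso.refl_trans]
  · change (admitsHomTo A₂).ι.isoWhiskerLeft γ = α.symm ≪≫ α'
    change α ≪≫ (admitsHomTo A₂).ι.isoWhiskerLeft γ = α' at hγ
    rw [← hγ, ← Iso.trans_assoc, Iso.symm_self_id, Iso.refl_trans]

/-- **Consequence: the named fact `ThmA4` is equivalent to its EXISTENCE half.** With the uniqueness clause
proved (`thmA4_unique`), [SemiAnbd] Thm. A.4 as typed (`ThmA4`, QuasiTemperoidsQDPairs) holds iff every
morphism of connected quasi-temperoids `φ : T₁[A₁] → T₂[A₂]` is the restriction of SOME morphism of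
temperoids `ψ : T₁ → T₂` (a 1-commutation `φ^* ⋙ λ₁^* ≅ λ₂^* ⋙ ψ^*` exists) — the half that the printed
proof builds through QD-pairs (pp. 83–86). [cite: MochizukiSemiAnbd2006, Thm A.4 pp.82-86] -/
theorem thmA4_iff_exists : Literature.AnabelianGeometry.SemiGraphs.ThmA4.{v₁, v₂, u, u₁, u₂} ↔
    ∀ (T₁ : Type u₁) [Category.{v₁} T₁] (T₂ : Type u₂) [Category.{v₂} T₂],
      IsConnectedTemperoid.{v₁, u, u₁} T₁ → IsConnectedTemperoid.{v₂, u, u₂} T₂ →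
      ∀ (A₁ : T₁) (A₂ : T₂), IsConnectedObj A₁ → IsConnectedObj A₂ →
      ∀ φ : TemperoidHom (Over' A₁) (Over' A₂), φ.PreservesNondegenerate →
        ∃ ψ : TemperoidHom T₁ T₂,
          Nonempty (φ.pullback ⋙ (admitsHomTo A₁).ι ≅ (admitsHomTo A₂).ι ⋙ ψ.pullback) := by
  constructor
  · intro h T₁ _ T₂ _ h₁ h₂ A₁ A₂ hA₁ hA₂ φ hφ
    obtain ⟨ψ, α, -⟩ := h T₁ T₂ h₁ h₂ A₁ A₂ hA₁ hA₂ φ hφ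
    exact ⟨ψ, ⟨α⟩⟩
  · intro h T₁ _ T₂ _ h₁ h₂ A₁ A₂ hA₁ hA₂ φ hφ
    obtain ⟨ψ, ⟨α⟩⟩ := h T₁ T₂ h₁ h₂ A₁ A₂ hA₁ hA₂ φ hφ
    exact ⟨ψ, α, fun ψ' α' => thmA4_unique h₂ hA₂ φ ψ ψ' α α'⟩

end Literature.AnabelianGeometry.SemiGraphs
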